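import Summits.ABC.ABC.Theorems.IneffectiveSubspaceTowerFourSubLiouvilleCoreIff
import Summits.ABC.ABC.Theorems.TowerFourSubLiouville.Negative.DialCalibration

/-!
# `TowerFourSubLiouville` (stmt-ABC-1649): the uniform binomial quartic saving is at most `3/2`

Negative-side calibration of the ONE open stub of line `fourth-radical-binomial-thue`
(`stub_genericFormsSaving`, kernel-certified crux-EQUIVALENT by
`Summit.ABC.ABC.Theorems.TowerFourSubLiouville.towerFourSubLiouville_iff_core`, p87895):

  `∃ η > 0, ∃ H Z₀, ∀ v w Y Z, Z₀ ≤ Z → H < max v w → v, w fourth-power-free → v, w, Y > 0 →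
     gcd(vY, wZ) = 1 → max(v,w) ≤ Z^η → wZ⁴ ≠ vY⁴ → |wZ⁴ − vY⁴| > Z^η`.

Per form, Thue–Siegel–Roth gives EVERY saving `η < 2` (landed `stub_fixedFormsRoth`), so a naive reading of the
core is "Roth, uniformly".  This file shows that the uniform exponent is genuinely smaller: **no `η > 3/2` can be
a witness** (`genericFormsSaving_witness_le_three_halves`), because of an explicit POLYNOMIAL (Padé-type) enemy
family (standing disprover, cycle 3, refuter-cdisprove-stmt-ABC-1649-g3-0):

* `padeFamily₂` (degree 2; found by the odd-symmetric ansatz `Z = P(s)`, `Y = P(−s)`, `w = Q(s)`, `v = Q(−s)` with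
  `P = s² − s/2 − 1/5`, `Q = s² + 2s + 21/20`, then `s = 42k + 1` and clearing denominators):
  `Z = 17640k² + 630k + 3`, `Y = 17640k² + 1050k + 13`, `w = 35280k² + 3360k + 81`, `v = 35280k² + 1`,
  `vY⁴ − wZ⁴ = 2000(42k+1)(26460k² + 1260k + 11)` (so `0 < vY⁴ − wZ⁴`, `(vY⁴ − wZ⁴)² ≤ 64·10⁶·Z³`),
  `max(v,w) = w ≤ 27 Z`, and `gcd(vY, wZ) = 1` for EVERY `k` (four Bezout identities with right sides
  `4, 84, 7, 7`, killed by `s ≡ 1 (mod 42)`).  `k = 0` is `13⁴ − 81·3⁴ = 22000`.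
  In the two-parameter language (coefficients `≍ Z^θ`, value `≍ Z^φ`) this family sits at `(θ, φ) = (1, 3/2)`.
* `padeFamily₁` (degree 1, the `[2/2]` Padé approximant of `(1 + 1/t)⁴`, `t = 5k + 5`):
  `v = 50k² + 90k + 41`, `Y = 5k + 6`, `w = 50k² + 130k + 85`, `Z = 5k + 5`, `vY⁴ − wZ⁴ = 10k + 11 = 2Z + 1`,
  `max(v,w) ≤ 4Z²`, coprime for every `k`: the corner `(θ, φ) = (2, 1)` — the VALUE of a coprime binomial
  quartic form can be as small as `2Z + 1` once the coefficients may reach `4Z²`.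

Consequences proved here (all unconditional, sorry-free):
* `not_ubq_of_three_halves_lt`: for every real `η > 3/2` the uniform saving `UBQ η` (the hypothesis of the landed
  `stub_transfer`, all coefficient pairs) FAILS.
* `genericFormsSaving_witness_le_three_halves`: for every `η > 3/2` and EVERY box `H`, the off-box fourth-power-free
  saving `UBQOff H η` (the matrix of `stub_genericFormsSaving`) FAILS — glue: the landed Roth stratum
  `stub_fixedFormsRoth` on the box + the fourth-power-free reduction of `towerFourSubLiouville_iff_core`
  would turn `UBQOff H η'`, `η' = min η (7/4) < 2`, into `UBQ η'`.
So any witness `(η, H, Z₀)` of the core has `η ≤ 3/2`: uniformity in the coefficients costs at least `1/2` against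
Roth's per-form `2 − ε`.  Calibration summary for the provers: `ABC ⟹` the core for every `η < 8/13` (skeleton's
`AbcGivesUBQ`); polynomial identities `wZ⁴ − vY⁴ = a` of degree `z` in the parameter obey the Mason–Stothers floor
`max(deg v, deg w, deg a) ≥ z + 1` (so they never reach `η ≤ 1`; rational identities are known to this seat for
`z = 1, 2` only — the symmetric `z = 3` scheme `125c⁶ + 875c⁵ + 3175c⁴ + 5625c³ + 5840c² + 1616c + 320 = 0` has no
real point); the probabilistic critical value is `η* = 1`.  The interval `(8/13, 3/2]` — and unconditionally
`(0, 3/2]` — is where the core lives.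
-/

-- `Summit.ABC.ABC` is the mandated summit-side namespace (CONVENTIONS §2); the duplicate is deliberate.
set_option linter.dupNamespace false

namespace Summit.ABC.ABC.Theorems.TowerFourSubLiouville.Negative

open Summit.ABC.ABC.Theses.IneffectiveSubspace

/-! ## A coprimality tool: an integer combination with a harmless right side -/

/-- If `a·x + b·y = r` over `ℤ` and `gcd(r, x) = 1` then `gcd(x, y) = 1`. -/
theorem coprime_of_int_combination {x y r : ℕ} {a b : ℤ} (h : a * x + b * y = r)
    (hr : Nat.Coprime r x) : Nat.Coprime x y := by
  set d := Nat.gcd x y with hd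
  have hdx : d ∣ x := Nat.gcd_dvd_left x y
  have hdy : d ∣ y := Nat.gcd_dvd_right x y
  have hdr : (d : ℤ) ∣ (r : ℤ) := by
    rw [← h]
    exact dvd_add (dvd_mul_of_dvd_right (Int.natCast_dvd_natCast.mpr hdx) _)
      (dvd_mul_of_dvd_right (Int.natCast_dvd_natCast.mpr hdy) _)
  have hdr' : d ∣ r := Int.natCast_dvd_natCast.mp hdr
  have h1 : d ∣ Nat.gcd r x := Nat.dvd_gcd hdr' hdx
  rw [Nat.Coprime.gcd_eq_one hr] at h1
  exact Nat.dvd_one.mp h1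

/-! ## The degree-2 Padé family `padeFamily₂` -/

/-- The identity of the degree-2 family: `vY⁴ = wZ⁴ + a` with
`a = 2000(42k+1)(26460k²+1260k+11)`. -/
theorem padeFamily₂_identity (k : ℕ) :
    (35280 * k ^ 2 + 1) * (17640 * k ^ 2 + 1050 * k + 13) ^ 4 =
      (35280 * k ^ 2 + 3360 * k + 81) * (17640 * k ^ 2 + 630 * k + 3) ^ 4 +
        2000 * (42 * k + 1) * (26460 * k ^ 2 + 1260 * k + 11) := by
  ring

/-- Coprimality of the degree-2 family: `gcd(vY, wZ) = 1` for every `k` (Bezout identities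
`(84k+1)Y − (84k+3)Z = 4`, `(42k+3)v + (1−42k)w = 84`, `(126k+4)v + (1−252k)Z = 7`,
`(252k+13)Y − (126k+2)w = 7`, and `Y`, `v` odd, `v ≡ 1 (mod 84)`, `Y ≡ 6 (mod 7)`). -/
theorem padeFamily₂_coprime (k : ℕ) :
    Nat.Coprime ((35280 * k ^ 2 + 1) * (17640 * k ^ 2 + 1050 * k + 13))
      ((35280 * k ^ 2 + 3360 * k + 81) * (17640 * k ^ 2 + 630 * k + 3)) := by
  have hv84 : Nat.Coprime 84 (35280 * k ^ 2 + 1) := by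
    have e : 35280 * k ^ 2 + 1 = 84 * (420 * k ^ 2) + 1 := by ring
    rw [e]
    exact (Nat.coprime_mul_left_add_right 84 1 (420 * k ^ 2)).mpr (Nat.coprime_one_right 84)
  have hv7 : Nat.Coprime 7 (35280 * k ^ 2 + 1) :=
    Nat.Coprime.coprime_dvd_left (by norm_num : 7 ∣ 84) hv84
  have hY2 : Nat.Coprime 2 (17640 * k ^ 2 + 1050 * k + 13) := by
    have e : 17640 * k ^ 2 + 1050 * k + 13 = 2 * (8820 * k ^ 2 + 525 * k + 6) + 1 := by ring
    rw [e]
    exact (Nat.coprime_mul_left_add_right 2 1 _).mpr (Nat.coprime_one_right 2)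
  have hY4 : Nat.Coprime 4 (17640 * k ^ 2 + 1050 * k + 13) := by
    have h := Nat.Coprime.pow_left 2 hY2
    rwa [show (2 : ℕ) ^ 2 = 4 from rfl] at h
  have hY7 : Nat.Coprime 7 (17640 * k ^ 2 + 1050 * k + 13) := by
    have e : 17640 * k ^ 2 + 1050 * k + 13 = 7 * (2520 * k ^ 2 + 150 * k + 1) + 6 := by ring
    rw [e]
    exact (Nat.coprime_mul_left_add_right 7 6 _).mpr (by norm_num)
  -- the four pairs
  have hYZ : Nat.Coprime (17640 * k ^ 2 + 1050 * k + 13) (17640 * k ^ 2 + 630 * k + 3) :=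
    coprime_of_int_combination (a := 84 * k + 1) (b := -(84 * k + 3)) (r := 4)
      (by push_cast; ring) hY4
  have hvw : Nat.Coprime (35280 * k ^ 2 + 1) (35280 * k ^ 2 + 3360 * k + 81) :=
    coprime_of_int_combination (a := 42 * k + 3) (b := 1 - 42 * k) (r := 84)
      (by push_cast; ring) hv84
  have hvZ : Nat.Coprime (35280 * k ^ 2 + 1) (17640 * k ^ 2 + 630 * k + 3) :=
    coprime_of_int_combination (a := 126 * k + 4) (b := 1 - 252 * k) (r := 7)
      (by push_cast; ring) hv7
  have hYw : Nat.Coprime (17640 * k ^ 2 + 1050 * k + 13) (35280 * k ^ 2 + 3360 * k + 81) :=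
    coprime_of_int_combination (a := 252 * k + 13) (b := -(126 * k + 2)) (r := 7)
      (by push_cast; ring) hY7
  exact Nat.Coprime.mul_left (Nat.Coprime.mul_right hvw hvZ) (Nat.Coprime.mul_right hYw hYZ)

/-- Sizes in the degree-2 family: `v ≤ w ≤ 27 Z`, `k ≤ Z`, `3 ≤ Z`, and `a² ≤ 64·10⁶ · Z³`. -/
theorem padeFamily₂_sizes (k : ℕ) :
    35280 * k ^ 2 + 1 ≤ 35280 * k ^ 2 + 3360 * k + 81 ∧
    35280 * k ^ 2 + 3360 * k + 81 ≤ 27 * (17640 * k ^ 2 + 630 * k + 3) ∧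
    k ≤ 17640 * k ^ 2 + 630 * k + 3 ∧ 3 ≤ 17640 * k ^ 2 + 630 * k + 3 ∧
    (2000 * (42 * k + 1) * (26460 * k ^ 2 + 1260 * k + 11)) ^ 2 ≤
      64000000 * (17640 * k ^ 2 + 630 * k + 3) ^ 3 := by
  refine ⟨by omega, Nat.le.intro (k := 441000 * k ^ 2 + 13650 * k) (by ring),
    Nat.le.intro (k := 17640 * k ^ 2 + 629 * k + 3) (by ring), by omega, ?_⟩
  have h1 : (42 * k + 1) ^ 2 ≤ 17640 * k ^ 2 + 630 * k + 3 :=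
    Nat.le.intro (k := 15876 * k ^ 2 + 546 * k + 2) (by ring)
  have h2 : 26460 * k ^ 2 + 1260 * k + 11 ≤ 4 * (17640 * k ^ 2 + 630 * k + 3) :=
    Nat.le.intro (k := 44100 * k ^ 2 + 1260 * k + 1) (by ring)
  calc (2000 * (42 * k + 1) * (26460 * k ^ 2 + 1260 * k + 11)) ^ 2
      = 4000000 * (42 * k + 1) ^ 2 * (26460 * k ^ 2 + 1260 * k + 11) ^ 2 := by ring
    _ ≤ 4000000 * (17640 * k ^ 2 + 630 * k + 3) * (4 * (17640 * k ^ 2 + 630 * k + 3)) ^ 2 := by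
        gcongr
    _ = 64000000 * (17640 * k ^ 2 + 630 * k + 3) ^ 3 := by ring

/-- **The degree-2 enemy family, packaged** (pure arithmetic): beyond every height there is a coprime
binomial quartic quadruple with coefficients `≤ 27 Z` and value `0 < vY⁴ − wZ⁴ ≤ 8000 · Z^{3/2}`
(stated as `a² ≤ 64·10⁶ Z³`). -/
theorem exists_padeFamily₂ (N : ℕ) : ∃ v w Y Z a : ℕ, N ≤ Z ∧ 3 ≤ Z ∧ 0 < v ∧ 0 < w ∧ 0 < Y ∧ 0 < a ∧
    Nat.Coprime (v * Y) (w * Z) ∧ v * Y ^ 4 = w * Z ^ 4 + a ∧ v ≤ w ∧ w ≤ 27 * Z ∧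
    a ^ 2 ≤ 64000000 * Z ^ 3 := by
  obtain ⟨hvw, hw, hk, h3, ha⟩ := padeFamily₂_sizes N
  exact ⟨35280 * N ^ 2 + 1, 35280 * N ^ 2 + 3360 * N + 81, 17640 * N ^ 2 + 1050 * N + 13,
    17640 * N ^ 2 + 630 * N + 3, 2000 * (42 * N + 1) * (26460 * N ^ 2 + 1260 * N + 11),
    hk, h3, by positivity, by positivity, by positivity, by positivity, padeFamily₂_coprime N,
    padeFamily₂_identity N, hvw, hw, ha⟩

/-! ## The degree-1 Padé family `padeFamily₁` (the corner `(θ, φ) = (2, 1)`) -/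

/-- The `[2/2]` Padé identity of `(1 + 1/t)⁴` at `t = 5k + 5`: `vY⁴ = wZ⁴ + (2Z + 1)`. -/
theorem padeFamily₁_identity (k : ℕ) :
    (50 * k ^ 2 + 90 * k + 41) * (5 * k + 6) ^ 4 =
      (50 * k ^ 2 + 130 * k + 85) * (5 * k + 5) ^ 4 + (10 * k + 11) := by
  ring

/-- Coprimality of the degree-1 family (Bezout right sides `20, 1, 1, 1`; `v ≡ 1 (mod 10)`). -/
theorem padeFamily₁_coprime (k : ℕ) :
    Nat.Coprime ((50 * k ^ 2 + 90 * k + 41) * (5 * k + 6)) ((50 * k ^ 2 + 130 * k + 85) * (5 * k + 5)) := by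
  have hv10 : Nat.Coprime 10 (50 * k ^ 2 + 90 * k + 41) := by
    have e : 50 * k ^ 2 + 90 * k + 41 = 10 * (5 * k ^ 2 + 9 * k + 4) + 1 := by ring
    rw [e]
    exact (Nat.coprime_mul_left_add_right 10 1 _).mpr (Nat.coprime_one_right 10)
  have hv20 : Nat.Coprime 20 (50 * k ^ 2 + 90 * k + 41) :=
    Nat.Coprime.coprime_dvd_left (by norm_num : 20 ∣ 10 ^ 2) (Nat.Coprime.pow_left 2 hv10)
  have hvw : Nat.Coprime (50 * k ^ 2 + 90 * k + 41) (50 * k ^ 2 + 130 * k + 85) :=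
    coprime_of_int_combination (a := 10 * k + 15) (b := -(10 * k + 7)) (r := 20)
      (by push_cast; ring) hv20
  have hvZ : Nat.Coprime (50 * k ^ 2 + 90 * k + 41) (5 * k + 5) :=
    coprime_of_int_combination (a := 1) (b := -(10 * k + 8)) (r := 1)
      (by push_cast; ring) (Nat.coprime_one_left _)
  have hYw : Nat.Coprime (5 * k + 6) (50 * k ^ 2 + 130 * k + 85) :=
    coprime_of_int_combination (a := -(10 * k + 14)) (b := 1) (r := 1)
      (by push_cast; ring) (Nat.coprime_one_left _)
  have hYZ : Nat.Coprime (5 * k + 6) (5 * k + 5) :=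
    coprime_of_int_combination (a := 1) (b := -1) (r := 1)
      (by push_cast; ring) (Nat.coprime_one_left _)
  exact Nat.Coprime.mul_left (Nat.Coprime.mul_right hvw hvZ) (Nat.Coprime.mul_right hYw hYZ)

/-- **The degree-1 enemy family, packaged**: beyond every height a coprime quadruple with
coefficients `≤ 4Z²` and value EXACTLY `2Z + 1`. -/
theorem exists_padeFamily₁ (N : ℕ) : ∃ v w Y Z : ℕ, N ≤ Z ∧ 0 < v ∧ 0 < w ∧ 0 < Y ∧ 0 < Z ∧
    Nat.Coprime (v * Y) (w * Z) ∧ v * Y ^ 4 = w * Z ^ 4 + (2 * Z + 1) ∧ v ≤ w ∧ w ≤ 4 * Z ^ 2 := by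
  refine ⟨50 * N ^ 2 + 90 * N + 41, 50 * N ^ 2 + 130 * N + 85, 5 * N + 6, 5 * N + 5, by omega,
    by positivity, by positivity, by positivity, by omega, padeFamily₁_coprime N, ?_, by omega,
    Nat.le.intro (k := 50 * N ^ 2 + 70 * N + 15) (by ring)⟩
  rw [padeFamily₁_identity N]
  ring

/-! ## Real-exponent consequences -/

/-- Growth bookkeeping: for `η > 3/2` and all large naturals `Z`, `27 Z ≤ Z^η` and
`64·10⁶ · Z³ < Z^{2η}`. -/
theorem eventually_sizes_lt_rpow {η : ℝ} (hη : 3 / 2 < η) :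
    ∃ N : ℕ, ∀ Z : ℕ, N ≤ Z → (27 * Z : ℝ) ≤ (Z : ℝ) ^ η ∧
      (64000000 : ℝ) * (Z : ℝ) ^ 3 < ((Z : ℝ) ^ η) ^ 2 := by
  have hη0 : 0 < η := by linarith
  -- 27 Z ≤ Z^η : key_growth with T = Z^η, s = 1/η
  obtain ⟨M₁, hM₁, h₁⟩ := key_growth (K := 27) (s := 1 / η) (by norm_num)
    (by rw [div_lt_one hη0]; linarith)
  -- 2 · 64e6 · Z³ ≤ Z^{2η} : key_growth with T = Z^{2η}, s = 3/(2η)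
  obtain ⟨M₂, hM₂, h₂⟩ := key_growth (K := 2 * 64000000) (s := 3 / (2 * η)) (by norm_num)
    (by rw [div_lt_one (by linarith)]; linarith)
  obtain ⟨N, hN⟩ := exists_nat_ge (max M₁ M₂)
  refine ⟨max N 1, fun Z hZ => ?_⟩
  have hZ1 : (1 : ℝ) ≤ Z := by exact_mod_cast le_trans (le_max_right _ _) hZ
  have hZ0 : (0 : ℝ) < Z := by linarith
  have hZN : (N : ℝ) ≤ Z := by exact_mod_cast le_trans (le_max_left _ _) hZ
  have hZle : (Z : ℝ) ≤ (Z : ℝ) ^ η := by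
    calc (Z : ℝ) = (Z : ℝ) ^ (1 : ℝ) := (Real.rpow_one _).symm
      _ ≤ (Z : ℝ) ^ η := Real.rpow_le_rpow_of_exponent_le hZ1 (by linarith)
  constructor
  · have hT : M₁ ≤ (Z : ℝ) ^ η := by linarith [le_max_left M₁ M₂]
    have := h₁ _ hT
    rwa [← Real.rpow_mul hZ0.le, mul_one_div_cancel hη0.ne', Real.rpow_one] at this
  · have h2η : (Z : ℝ) ≤ (Z : ℝ) ^ (2 * η) := by
      calc (Z : ℝ) = (Z : ℝ) ^ (1 : ℝ) := (Real.rpow_one _).symm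
        _ ≤ (Z : ℝ) ^ (2 * η) := Real.rpow_le_rpow_of_exponent_le hZ1 (by linarith)
    have hT : M₂ ≤ (Z : ℝ) ^ (2 * η) := by linarith [le_max_right M₁ M₂]
    have h := h₂ _ hT
    rw [← Real.rpow_mul hZ0.le, show 2 * η * (3 / (2 * η)) = ((3 : ℕ) : ℝ) by field_simp; ring,
      Real.rpow_natCast] at h
    have hsq : ((Z : ℝ) ^ η) ^ 2 = (Z : ℝ) ^ (2 * η) := by
      rw [mul_comm, Real.rpow_mul hZ0.le]; norm_num
    rw [hsq]
    have hpos : (0 : ℝ) < (Z : ℝ) ^ 3 := by positivity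
    linarith

/-- **`UBQ η` fails for every `η > 3/2`.**  There is no height beyond which every admissible quadruple
with `max(v,w) ≤ Z^η` has `|wZ⁴ − vY⁴| > Z^η`: the degree-2 Padé family violates it.  (The matrix is
the hypothesis `UBQ η` of the landed `stub_transfer`, unfolded verbatim.) -/
theorem not_ubq_of_three_halves_lt (η : ℝ) (hη : 3 / 2 < η) :
    ¬ ∃ Z₀ : ℕ, ∀ v w Y Z : ℕ, Z₀ ≤ Z → 0 < v → 0 < w → 0 < Y → Nat.Coprime (v * Y) (w * Z) →
      ((max v w : ℕ) : ℝ) ≤ (Z : ℝ) ^ η → w * Z ^ 4 ≠ v * Y ^ 4 →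
      (Z : ℝ) ^ η < |((w * Z ^ 4 : ℕ) : ℝ) - ((v * Y ^ 4 : ℕ) : ℝ)| := by
  rintro ⟨Z₀, h⟩
  obtain ⟨N, hN⟩ := eventually_sizes_lt_rpow hη
  obtain ⟨v, w, Y, Z, a, hNZ, _h3, hv, hw, hY, ha, hcop, hid, hvw, hw27, ha2⟩ :=
    exists_padeFamily₂ (max Z₀ N)
  obtain ⟨h27, hcube⟩ := hN Z (le_trans (le_max_right _ _) hNZ)
  have hmax : ((max v w : ℕ) : ℝ) ≤ (Z : ℝ) ^ η := by
    rw [max_eq_right hvw]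
    have : (w : ℝ) ≤ 27 * Z := by exact_mod_cast hw27
    linarith
  have hne : w * Z ^ 4 ≠ v * Y ^ 4 := by rw [hid]; omega
  have key := h v w Y Z (le_trans (le_max_left _ _) hNZ) hv hw hY hcop hmax hne
  have habs : |((w * Z ^ 4 : ℕ) : ℝ) - ((v * Y ^ 4 : ℕ) : ℝ)| = a := by
    rw [hid]; push_cast
    rw [show ((w : ℝ) * (Z : ℝ) ^ 4 - ((w : ℝ) * (Z : ℝ) ^ 4 + a)) = -(a : ℝ) by ring, abs_neg,
      abs_of_nonneg (by positivity)]
  rw [habs] at key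
  -- key : Z^η < a, but a² ≤ 64e6 Z³ < (Z^η)²
  have ha2R : (a : ℝ) ^ 2 ≤ 64000000 * (Z : ℝ) ^ 3 := by exact_mod_cast ha2
  have hlt : (a : ℝ) ^ 2 < ((Z : ℝ) ^ η) ^ 2 := lt_of_le_of_lt ha2R hcube
  have hZη : (0 : ℝ) ≤ (Z : ℝ) ^ η := Real.rpow_nonneg (by positivity) _
  have : (a : ℝ) < (Z : ℝ) ^ η := lt_of_pow_lt_pow_left₀ 2 hZη hlt
  linarith

/-- **Any witness of the core stub has `η ≤ 3/2`.**  For every `η > 3/2` and EVERY box `H`, the off-box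
fourth-power-free saving (the matrix of `stub_genericFormsSaving`, unfolded verbatim) fails.  Glue: with
`η' = min η (7/4) ∈ (3/2, 2)`, the landed Roth stratum `stub_fixedFormsRoth H η'` and the fourth-power-free
reduction (`coreIff_exists_eq_mul_pow_four`, `coreIff_saving_of_reduced`, `coreIff_saving_mono`) would give
`UBQ η'`, contradicting `not_ubq_of_three_halves_lt`. -/
theorem genericFormsSaving_witness_le_three_halves (η : ℝ) (hη : 3 / 2 < η) (H : ℕ) :
    ¬ ∃ Z₀ : ℕ, ∀ v w Y Z : ℕ, Z₀ ≤ Z → H < max v w → (∀ t : ℕ, t ^ 4 ∣ v → t = 1) →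
      (∀ t : ℕ, t ^ 4 ∣ w → t = 1) → 0 < v → 0 < w → 0 < Y → Nat.Coprime (v * Y) (w * Z) →
      ((max v w : ℕ) : ℝ) ≤ (Z : ℝ) ^ η → w * Z ^ 4 ≠ v * Y ^ 4 →
      (Z : ℝ) ^ η < |((w * Z ^ 4 : ℕ) : ℝ) - ((v * Y ^ 4 : ℕ) : ℝ)| := by
  rintro ⟨Z₀, hoff⟩
  set η' : ℝ := min η (7 / 4) with hη'def
  have hη'1 : 3 / 2 < η' := lt_min hη (by norm_num)
  have hη'0 : 0 < η' := by linarith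
  have hη'2 : η' < 2 := lt_of_le_of_lt (min_le_right _ _) (by norm_num)
  obtain ⟨Z₁, hon⟩ := stub_fixedFormsRoth H η' hη'0 hη'2
  refine not_ubq_of_three_halves_lt η' hη'1 ⟨max (max Z₀ Z₁) 1, fun v w Y Z hZ => ?_⟩
  intro hv hw hY hcop hmax hne
  have hZ1 : 1 ≤ Z := le_trans (le_max_right _ _) hZ
  obtain ⟨v₀, s, _hv₀, hs, hvs, hvf⟩ := coreIff_exists_eq_mul_pow_four hv
  obtain ⟨w₀, t, _hw₀, ht, hwt, hwf⟩ := coreIff_exists_eq_mul_pow_four hw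
  have htZ : Z ≤ t * Z := Nat.le_mul_of_pos_left Z ht
  have hZ₀ : Z₀ ≤ t * Z := le_trans (le_trans (le_trans (le_max_left _ _) (le_max_left _ _)) hZ) htZ
  have hZ₁ : Z₁ ≤ t * Z := le_trans (le_trans (le_trans (le_max_right _ _) (le_max_left _ _)) hZ) htZ
  have htZ1 : 1 ≤ t * Z := le_trans hZ1 htZ
  have hred : 0 < v₀ → 0 < w₀ → 0 < s * Y → Nat.Coprime (v₀ * (s * Y)) (w₀ * (t * Z)) →
      ((max v₀ w₀ : ℕ) : ℝ) ≤ ((t * Z : ℕ) : ℝ) ^ η' → w₀ * (t * Z) ^ 4 ≠ v₀ * (s * Y) ^ 4 →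
      ((t * Z : ℕ) : ℝ) ^ η' < |((w₀ * (t * Z) ^ 4 : ℕ) : ℝ) - ((v₀ * (s * Y) ^ 4 : ℕ) : ℝ)| := by
    rcases Nat.lt_or_ge H (max v₀ w₀) with hlt | hle
    · exact coreIff_saving_mono (min_le_left η (7 / 4)) htZ1 (hoff v₀ w₀ (s * Y) (t * Z) hZ₀ hlt hvf hwf)
    · exact hon v₀ w₀ (s * Y) (t * Z) hZ₁ hle
  exact coreIff_saving_of_reduced hη'0.le hs ht hvs hwt hred hv hw hY hcop hmax hne

end Summit.ABC.ABC.Theorems.TowerFourSubLiouville.Negative
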